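import Literature.Barriers.QuantumAdvantage.TensorNetworkContractionSegments
import Literature.Barriers.QuantumAdvantage.TensorNetworkContractionTreewidth
import Mathlib.Combinatorics.SimpleGraph.Connectivity.Subgraph
import HarnessLib

/-!
# Barrier catalogue `QuantumAdvantage` — treewidth of the segment network from the treewidth of the circuit graph

Companion to `TensorNetworkContractionSegments.lean` (the segment tensor network `N(C; z₀, obs)`,
whose value is the Born weight, Markov–Shi Prop. 3.5) and `TensorNetworkContractionTreewidth.lean`
(`tw(G_C) ≤ 2r + 1`). The cost of contracting `N(C; z₀, obs)` is governed by the treewidth of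
its primal graph — two segments adjacent iff a common tensor carries them, i.e. the line graph
`G_C*` of the circuit multigraph (Markov–Shi §4, Prop. 4.2: `cc(G) = tw(G*)`). As in their
Lemma 4.4 ("from a tree decomposition `𝒯` of `G` of width `d` we obtain a tree decomposition
`𝒯*` of `G*` of width `(d+1)·Δ(G) - 1` by replacing each vertex `v` with all edges incident to
`v`"), a tree decomposition of the circuit graph `circuitGraph C` yields one of the primal graph
by replacing every node by its scope (the segments incident to it):

* `Seg.startNode s` (the node at which the segment `s` starts), `Seg.consecutive_of_mem_scope` (any
  other tensor carrying `s` is the next node of the wire: the edge of `G_C` that `s` is),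
  `segDecomposition` (the decomposition `𝒯*`), `card_scope_segmentNetwork_le`;
* **`treewidth_primalGraph_segmentNetwork_le`**:
  `tw(N*) ≤ (2q + 1)·(tw(G_C) + 1) - 1` when every gate acts on `≤ q` wires (the maximum degree
  of `G_C` is `2q`; `Literature.Combinatorics.SimpleGraph.treewidth_lineGraph_le` is the
  simple-graph case, here parallel segments are distinct indices);
* **`treewidth_primalGraph_segmentNetwork_le_of_cutParam`**: with `treewidth_circuitGraph_le`,
  `tw(N*) ≤ (2q + 1)·(2r + 2) - 1` under a wire ordering with cut parameter `r` — the width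
  parameter of Markov–Shi's contraction of `N(C; x, τ)` for the circuits of Prop. 5.1.

## References

* [MarkovShi2008] I. L. Markov, Y. Shi, SIAM J. Comput. 38 (2008) 963–981
  (arXiv:quant-ph/0511069), §4 (the line graph `G*`, Prop. 4.2, Lemma 4.4 and its proof, p. 9),
  §5 (Prop. 5.1). Read via `lit read paper:arxiv-quant-ph_0511069`.
-/

noncomputable section

namespace Literature.Barriers.QuantumAdvantage

open Literature.Computability.Cryptography Literature.Computability.QuantumComplexity
  Literature.LinearAlgebra.TensorNetworks Literature.Combinatorics.SimpleGraph

variable {G : QGateSet} {N : ℕ}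

/-! ### More on canonical starts -/

/-- `canon C w` is monotone. [folklore] -/
theorem canon_mono (C : QCircuit G N) (w : Fin N) : Monotone (canon C w) := by
  refine monotone_nat_of_le_succ fun t => ?_
  by_cases ht : t < C.gates.length
  · by_cases hw : w ∈ (C.gates[t]).wires
    · rw [canon_succ_of_mem ht hw]; exact (canon_le C w t).trans (Nat.le_succ t)
    · rw [canon_succ_of_not_mem ht hw]
  · rw [show canon C w (t + 1) = canon C w t by simp [canon, ht]]

/-- A boundary `t + 1` starts a segment of `w` only if the gate `t` acts on `w`. [folklore] -/
theorem mem_wires_of_canon_succ {C : QCircuit G N} {w : Fin N} {t : ℕ}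
    (h : canon C w (t + 1) = t + 1) : ∃ ht : t < C.gates.length, w ∈ (C.gates[t]).wires := by
  by_cases ht : t < C.gates.length
  · by_cases hw : w ∈ (C.gates[t]).wires
    · exact ⟨ht, hw⟩
    · rw [canon_succ_of_not_mem ht hw] at h
      have := canon_le C w t
      omega
  · rw [show canon C w (t + 1) = canon C w t by simp [canon, ht]] at h
    have := canon_le C w t
    omega

/-- No gate acts on `w` strictly inside a segment of `w`: if `canon C w t = t₀` then no gate
`t'` with `t₀ ≤ t' < t` acts on `w`. [folklore] -/
theorem not_mem_wires_of_canon_eq {C : QCircuit G N} {w : Fin N} {t₀ t t' : ℕ}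
    (h : canon C w t = t₀) (h₁ : t₀ ≤ t') (h₂ : t' < t) (ht' : t' < C.gates.length) :
    w ∉ (C.gates[t']).wires := fun hw => by
  have h3 : canon C w (t' + 1) ≤ canon C w t := canon_mono C w (by omega)
  rw [canon_succ_of_mem ht' hw, h] at h3
  omega

/-! ### The node at which a segment starts -/

/-- The node of the circuit graph at which the segment `s = (w, t₀)` starts: the input vertex of
`w` if `t₀ = 0`, the gate `t₀ - 1` otherwise. [cite: MarkovShi2008, §2 (the graph G_C)] -/
def Seg.startNode {C : QCircuit G N} (s : Seg C) : CircuitNode C.gates.length N :=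
  if h : (s.1.2 : ℕ) = 0 then .input s.1.1
  else .gate ⟨(s.1.2 : ℕ) - 1, by have := s.1.2.isLt; omega⟩

/-- The start node lies on the segment's wire. [folklore] -/
theorem Seg.onWire_startNode {C : QCircuit G N} (s : Seg C) : OnWire C s.1.1 s.startNode := by
  unfold Seg.startNode
  split_ifs with h
  · rfl
  · have hs : canon C s.1.1 ((s.1.2 : ℕ) - 1 + 1) = (s.1.2 : ℕ) - 1 + 1 := by
      rw [Nat.sub_add_cancel (Nat.pos_of_ne_zero h)]; exact s.2
    obtain ⟨_, hw⟩ := mem_wires_of_canon_succ hs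
    exact hw

/-- The time stamp of the start node is the starting boundary. [folklore] -/
theorem Seg.pos_startNode {C : QCircuit G N} (s : Seg C) : s.startNode.pos = (s.1.2 : ℕ) := by
  unfold Seg.startNode
  split_ifs with h
  · simp [CircuitNode.pos, h]
  · simp only [CircuitNode.pos]; omega

/-- A segment lies in the scope of its start node. [cite: MarkovShi2008, §3 (the network N(C))] -/
theorem Seg.mem_scope_startNode {C : QCircuit G N} (A : Language Bool) (z₀ : QReg N)
    (obs : Fin N → Bool → ℂ) (s : Seg C) :
    s ∈ (segmentNetwork C A z₀ obs).scope s.startNode := by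
  have key : ∀ t : Fin (C.gates.length + 1), (t : ℕ) = (s.1.2 : ℕ) → segAt C s.1.1 t = s := by
    intro t ht
    have : t = s.1.2 := Fin.ext ht
    subst this
    exact segAt_self s
  unfold Seg.startNode
  split_ifs with h
  · simp only [segmentNetwork, Finset.mem_singleton]
    exact (key 0 (by simp [h])).symm
  · have hs : canon C s.1.1 ((s.1.2 : ℕ) - 1 + 1) = (s.1.2 : ℕ) - 1 + 1 := by
      rw [Nat.sub_add_cancel (Nat.pos_of_ne_zero h)]; exact s.2
    obtain ⟨ht, hw⟩ := mem_wires_of_canon_succ hs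
    simp only [segmentNetwork, Finset.mem_biUnion, Finset.mem_insert, Finset.mem_singleton]
    refine ⟨s.1.1, hw, Or.inr (key _ ?_).symm⟩
    simp only [Fin.val_succ]
    omega

/-- **Any other tensor carrying a segment is the next node of its wire**: if `s` lies in the
scope of `u ≠ startNode s` then `u` is the node immediately after `startNode s` on the wire of
`s` — so `{startNode s, u}` is the edge of `G_C` that the segment `s` is.
[cite: MarkovShi2008, §2 (the graph G_C: "each wire segment can now be represented by an edge")] -/
theorem Seg.consecutive_of_mem_scope {C : QCircuit G N} {A : Language Bool} {z₀ : QReg N}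
    {obs : Fin N → Bool → ℂ} {s : Seg C} {u : CircuitNode C.gates.length N}
    (hu : s ∈ (segmentNetwork C A z₀ obs).scope u) (hne : u ≠ s.startNode) :
    Consecutive C s.1.1 s.startNode u := by
  obtain ⟨⟨w, t₀⟩, hs⟩ := s
  have hT := t₀.isLt
  refine ⟨Seg.onWire_startNode _, ?_, ?_, ?_⟩
  all_goals cases u with
    | input w' =>
      -- `segAt w' 0 = s` forces `w' = w`, `t₀ = 0`, i.e. `u = startNode s`
      exfalso
      simp only [segmentNetwork, Finset.mem_singleton] at hu
      have hw : w' = w := congrArg (fun s : Seg C => s.1.1) hu.symm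
      have ht : (t₀ : ℕ) = 0 := by
        have := congrArg (fun s : Seg C => ((s.1.2 : Fin _) : ℕ)) hu
        simp only [segAt, canon_zero, Fin.val_zero] at this
        omega
      apply hne
      subst hw
      simp [Seg.startNode, ht]
    | gate t =>
      simp only [segmentNetwork, Finset.mem_biUnion, Finset.mem_insert, Finset.mem_singleton] at hu
      obtain ⟨w', hw', h | h⟩ := hu
      · -- `s` is the segment alive before gate `t` on `w' = w`: `t` is the end gate
        have hw : w' = w := congrArg (fun s : Seg C => s.1.1) h.symm
        subst hw
        have hct : canon C w' t = t₀ := by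
          have := congrArg (fun s : Seg C => ((s.1.2 : Fin _) : ℕ)) h
          simpa [segAt] using this.symm
        have ht₀t : (t₀ : ℕ) ≤ t := hct ▸ canon_le C w' t
        first
        | exact hw'
        | (rw [Seg.pos_startNode]; simp only [CircuitNode.pos]; omega)
        | (intro z hz
           rw [Seg.pos_startNode]
           cases z with
           | input _ => exact Or.inl (Nat.zero_le _)
           | output _ => right; simp only [CircuitNode.pos]; have := t.isLt; omega
           | gate t' =>
             simp only [CircuitNode.pos]
             by_contra hcon
             simp only [not_or, not_le] at hcon
             exact not_mem_wires_of_canon_eq hct (by omega) (by omega) t'.isLt hz)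
      · -- `s` starts at gate `t`: then `u = startNode s`
        exfalso
        have hw : w' = w := congrArg (fun s : Seg C => s.1.1) h.symm
        subst hw
        have hct : (t₀ : ℕ) = t + 1 := by
          have := congrArg (fun s : Seg C => ((s.1.2 : Fin _) : ℕ)) h
          simp only [segAt, Fin.val_succ] at this
          rw [this, canon_succ_of_mem t.isLt hw']
        apply hne
        simp only [Seg.startNode, hct, Nat.add_one_ne_zero, ↓reduceDIte, Nat.add_sub_cancel]
    | output w' =>
      simp only [segmentNetwork, Finset.mem_singleton] at hu
      have hw : w' = w := congrArg (fun s : Seg C => s.1.1) hu.symm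
      subst hw
      have hct : canon C w' C.gates.length = t₀ := by
        have := congrArg (fun s : Seg C => ((s.1.2 : Fin _) : ℕ)) hu
        simpa [segAt] using this.symm
      first
      | rfl
      | (rw [Seg.pos_startNode]; simp only [CircuitNode.pos]; omega)
      | (intro z hz
         rw [Seg.pos_startNode]
         cases z with
         | input _ => exact Or.inl (Nat.zero_le _)
         | output _ => exact Or.inr le_rfl
         | gate t' =>
           simp only [CircuitNode.pos]
           by_contra hcon
           simp only [not_or, not_le] at hcon
           exact not_mem_wires_of_canon_eq hct (by omega) t'.isLt t'.isLt hz)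

/-- Two nodes both immediately after `a` on wire `w` coincide. [folklore] -/
theorem Consecutive.right_unique {C : QCircuit G N} {w : Fin N}
    {a u u' : CircuitNode C.gates.length N} (h : Consecutive C w a u) (h' : Consecutive C w a u') :
    u = u' := by
  have h1 := (h.2.2.2 u' h'.2.1).resolve_left (by have := h'.2.2.1; omega)
  have h2 := (h'.2.2.2 u h.2.1).resolve_left (by have := h.2.2.1; omega)
  exact h.2.1.eq_of_pos_eq h'.2.1 (le_antisymm h1 h2)

/-! ### The decomposition of the primal graph -/

section decomposition

variable {ι : Type*}

/-- **The decomposition `𝒯*` of the primal graph of the segment network** induced by a tree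
decomposition `𝒯` of the circuit graph: same tree, the bag at `i` being the union of the scopes
of the nodes in `B_i` (the segments incident to them).
[cite: MarkovShi2008, §4 (Lemma 4.4, proof)] -/
def segDecomposition {C : QCircuit G N} (A : Language Bool) (z₀ : QReg N) (obs : Fin N → Bool → ℂ)
    (D : TreeDecomposition (circuitGraph C) ι) :
    TreeDecomposition (segmentNetwork C A z₀ obs).primalGraph ι where
  tree := D.tree
  isTree := D.isTree
  bag i := (D.bag i).biUnion fun u => (segmentNetwork C A z₀ obs).scope u
  exists_mem_bag_of_adj := by
    intro s s' h
    obtain ⟨-, u, hu, hu'⟩ := (TensorNetwork.primalGraph_adj _ s s').1 h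
    obtain ⟨i, hi⟩ := D.exists_mem_bag u
    exact ⟨i, Finset.mem_biUnion.2 ⟨u, hi, hu⟩, Finset.mem_biUnion.2 ⟨u, hi, hu'⟩⟩
  connected_induce s := by
    classical
    set a := s.startNode with ha
    have hamem := Seg.mem_scope_startNode A z₀ obs s
    by_cases hex : ∃ u, u ≠ a ∧ s ∈ (segmentNetwork C A z₀ obs).scope u
    · obtain ⟨b, hba, hb⟩ := hex
      have hcons := Seg.consecutive_of_mem_scope hb hba
      have huniq : ∀ u, s ∈ (segmentNetwork C A z₀ obs).scope u → u = a ∨ u = b := fun u hu => by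
        by_cases hua : u = a
        · exact Or.inl hua
        · exact Or.inr ((Seg.consecutive_of_mem_scope hu hua).right_unique hcons ▸ rfl)
      have hset : {i | s ∈ (D.bag i).biUnion fun u => (segmentNetwork C A z₀ obs).scope u} =
          {i | a ∈ D.bag i} ∪ {i | b ∈ D.bag i} := by
        ext i
        simp only [Set.mem_setOf_eq, Finset.mem_biUnion, Set.mem_union]
        constructor
        · rintro ⟨u, hui, hu⟩
          rcases huniq u hu with rfl | rfl
          · exact Or.inl hui
          · exact Or.inr hui
        · rintro (h | h)
          · exact ⟨a, h, hamem⟩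
          · exact ⟨b, h, hb⟩
      rw [hset]
      have hadj : (circuitGraph C).Adj a b := circuitGraph_adj.2 ⟨hba.symm, Or.inl ⟨_, hcons⟩⟩
      obtain ⟨i, hia, hib⟩ := D.exists_mem_bag_of_adj hadj
      exact SimpleGraph.induce_union_connected (D.connected_induce a).preconnected
        (D.connected_induce b).preconnected ⟨i, hia, hib⟩
    · have hset : {i | s ∈ (D.bag i).biUnion fun u => (segmentNetwork C A z₀ obs).scope u} =
          {i | a ∈ D.bag i} := by
        ext i
        simp only [Set.mem_setOf_eq, Finset.mem_biUnion]
        constructor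
        · rintro ⟨u, hui, hu⟩
          by_cases hua : u = a
          · exact hua ▸ hui
          · exact absurd ⟨u, hua, hu⟩ hex
        · exact fun h => ⟨a, h, hamem⟩
      rw [hset]
      exact D.connected_induce a

end decomposition

/-- Scopes are small: a tensor of the segment network carries at most `2q + 1` indices if every
gate acts on at most `q` wires (inputs and outputs carry one, a gate on `a` wires carries `2a`).
[cite: MarkovShi2008, §3 (the network N(C))] -/
theorem card_scope_segmentNetwork_le {C : QCircuit G N} (A : Language Bool) (z₀ : QReg N) (obs : Fin N → Bool → ℂ)
    {q : ℕ} (hq : ∀ g ∈ C.gates, g.wires.card ≤ q) (u : CircuitNode C.gates.length N) :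
    ((segmentNetwork C A z₀ obs).scope u).card ≤ 2 * q + 1 := by
  cases u with
  | input w => simp [segmentNetwork]
  | output w => simp [segmentNetwork]
  | gate t =>
    simp only [segmentNetwork]
    refine (Finset.card_biUnion_le).trans ?_
    calc ∑ w ∈ (C.gates[(t : ℕ)]).wires, ({segAt C w t.castSucc, segAt C w t.succ} : Finset (Seg C)).card
        ≤ ∑ w ∈ (C.gates[(t : ℕ)]).wires, 2 := Finset.sum_le_sum fun w _ => Finset.card_le_two
      _ = 2 * (C.gates[(t : ℕ)]).wires.card := by rw [Finset.sum_const, smul_eq_mul, Nat.mul_comm]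
      _ ≤ 2 * q + 1 := by
        have := hq _ (List.getElem_mem t.isLt)
        omega

/-- **Treewidth of the segment network from the treewidth of the circuit graph** (Markov–Shi's
Lemma 4.4 for the circuit multigraph): if every gate acts on at most `q` wires then
`tw(N(C)*) ≤ (2q + 1)·(tw(G_C) + 1) - 1`. [cite: MarkovShi2008, §4 (Lemma 4.4)] -/
theorem treewidth_primalGraph_segmentNetwork_le (C : QCircuit G N) (A : Language Bool) (z₀ : QReg N)
    (obs : Fin N → Bool → ℂ) {q : ℕ} (hq : ∀ g ∈ C.gates, g.wires.card ≤ q) :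
    treewidth (segmentNetwork C A z₀ obs).primalGraph ≤
      (2 * q + 1) * (treewidth (circuitGraph C) + 1) - 1 := by
  classical
  obtain ⟨k, D, hD⟩ := exists_width_eq_treewidth (circuitGraph C)
  refine (treewidth_le_width (segDecomposition A z₀ obs D)).trans
    (TreeDecomposition.width_le _ fun i => ?_)
  have h1 : ((segDecomposition A z₀ obs D).bag i).card ≤ (2 * q + 1) * (D.bag i).card := by
    refine (Finset.card_biUnion_le).trans ?_
    calc ∑ u ∈ D.bag i, ((segmentNetwork C A z₀ obs).scope u).card
        ≤ ∑ u ∈ D.bag i, (2 * q + 1) := Finset.sum_le_sum fun u _ => card_scope_segmentNetwork_le A z₀ obs hq u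
      _ = (2 * q + 1) * (D.bag i).card := by rw [Finset.sum_const, smul_eq_mul, Nat.mul_comm]
  have h2 : (2 * q + 1) * (D.bag i).card ≤ (2 * q + 1) * (D.width + 1) :=
    Nat.mul_le_mul_left _ (D.card_bag_le_width_add_one i)
  rw [← hD]
  have h3 : 1 ≤ (2 * q + 1) * (D.width + 1) := Nat.one_le_iff_ne_zero.2 (by positivity)
  omega

/-- **The width parameter of Markov–Shi's contraction for the circuits of Prop. 5.1**: under a
wire ordering `σ` with cut parameter `r = cutParamUnder σ C`, and gates on `≤ q` wires each
(`q ≥ 1`), the primal graph of the segment network has treewidth `≤ (2q + 1)(2r + 2) - 1`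
(`treewidth_circuitGraph_le` and the previous theorem).
[cite: MarkovShi2008, §5 (Prop 5.1, proof) and §4 (Lemma 4.4)] -/
theorem treewidth_primalGraph_segmentNetwork_le_of_cutParam (σ : Fin N ≃ Fin N) (C : QCircuit G N)
    (A : Language Bool) (z₀ : QReg N) (obs : Fin N → Bool → ℂ) {q : ℕ}
    (hq : ∀ g ∈ C.gates, g.wires.card ≤ q) (hC : ∀ g ∈ C.gates, g.wires.Nonempty) :
    treewidth (segmentNetwork C A z₀ obs).primalGraph ≤
      (2 * q + 1) * (2 * C.cutParamUnder σ + 2) - 1 := by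
  refine (treewidth_primalGraph_segmentNetwork_le C A z₀ obs hq).trans ?_
  have h := treewidth_circuitGraph_le σ C hC
  exact Nat.sub_le_sub_right (Nat.mul_le_mul_left _ (by omega)) 1

end Literature.Barriers.QuantumAdvantage

end
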